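import Mathlib
import Literature.NumberTheory.LFunctions.Zhang2022.Section10cEval1214Tools
import HarnessLib

/-!
# Zhang (2022) §10 p. 57: the `m`-sum of `S_j(𝐚₁₁,𝐚₁₃)` on the LOW range `dr < P^{1/2}` —
# tool lemmas for the first line of `Z22:§10.u036` (`Typed.Sec10B.Eq1036a`)

Topic `Literature/NumberTheory/LFunctions/Zhang2022` (Landau–Siegel audit tree; verdict-neutral).
Y. Zhang, *Discrete mean estimates and the Landau–Siegel zero*, arXiv:2211.02515v1 (2022)
[Zhang2022LandauSiegel], §10 p. 57 (tex L2916): "By Lemma 10.2 and the results in Section 8, the sum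
over `dr < P^{0.5}` is equal to `(L′(1,χ)²/500)β_{j+1}β_{j+2}Σ_{n<P^{0.5}}|χ(n)|λ₀ⱼ(n)φ(n)⁻¹
(𝔣_{j6}(P^{0.504}/n)/0.504 + ι₂𝔣_{j7}(P^{0.5}/n)/0.5) + o(α)`" — **an unrefereed manuscript under
adjudication; theorem-only TOOL file (ZHANG-L discharge lane, WP10, seat zl-w10-p5, helper of
zl-w10-p3 under the leaf `Typed.Sec10B.Concl1113`); nothing here bears on its Theorems 1–2 or on
Landau–Siegel zeros.**

On the low range the `m`-sum `Σ_m χ(m)(ϰ₁(nm) + ι₂ϰ₂(nm))m^{−(1−β_j)}` of `S_j(𝐚₁₁,𝐚₁₃)` (`n = dr`,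
`Typed.Sec10B.mSum11`) keeps BOTH pieces (d41's `Section10Range1113.mSum11_eq` treats `n ≥ P₂`, where
`ϰ₂(nm) ≡ 0`). Here:

* `mSum11_eq_two_sums` — the exact split
  `mSum11 = (log P₁)⁻¹·S₆(P₁/n) + ι₂·(log P₂)⁻¹·S₇(P₂/n)`, `S_μ(x) = Σ_{m<x}χ(m)m^{β_j−1}(x/m)^{β_μ}log(x/m)`
  = Lemma 8.2's sum ((8.6); zl-w10-p1's generic `Sec10C.sum_vkGen_eq`);
* `lemma82Sum_eq_zero_of_le_one` — `S_μ(x) = 0` for `x ≤ 1` (so the `ϰ₂`-piece vanishes for `n ≥ P₂`);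
* `norm_lemma82Sum7_crude` — `|S₇(x)| ≤ (1 + log x)log x` for `x ≥ 1` (the `β₇`-twin of d41's
  `norm_lemma82Sum_crude`; the bound used where `x = P₂/n < T` and Lemma 8.2 does not reach);
* `norm_mSum11_sub_main_le` — the pointwise main-term comparison
  `‖mSum11 − (L′𝔣_{j6}(P₁/n)/log P₁ + ι₂L′𝔣_{j7}(P₂/n)/log P₂)‖ ≤ E₆/log P₁ + |ι₂|E₇/log P₂` from the two
  Lemma-8.2 errors `E₆`, `E₇` (pure algebra);
* `norm_frakfW7_P2_div_sub_le_low` — the printed main term uses `𝔣_{j7}(P^{1/2}/n)/(0.5 log P)` instead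
  of `𝔣_{j7}(P₂/n)/log P₂` (`P₂ = P^{1/2}T^{−10}`): for every `1 ≤ n < P^{1/2}` the two differ by
  `≤ 5000·𝓛^{1.1}·α/𝓛⁹` (zl-w10-p1's `norm_frakfW7_P2_div_sub_le`, whose window hypothesis
  `P^{0.496} ≤ n` is not needed).

0 definitions, 0 facts.

## References

* Y. Zhang, arXiv:2211.02515v1 (2022), §10 p. 57, Lemma 8.2 p. 46, (8.6) p. 45, (2.21)–(2.22).
  [cite: Zhang2022LandauSiegel, §10 p. 57]
-/

noncomputable section

open Complex Real Finset

namespace Literature.NumberTheory.LFunctions.Zhang2022.Skeleton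

open Literature.NumberTheory.LFunctions.Zhang2022.Typed
open Literature.NumberTheory.LFunctions.Zhang2022.Section8cProofs (betaJ_eq_real_mul_I)

variable (c' : ℝ) {D : ℕ} (χ : DirichletCharacter ℂ D)

/-! ## The exact split of the `m`-sum into two Lemma-8.2 sums -/

/-- For `𝓛 ≥ 2` and `n ≥ 1`: **the `m`-sum of `S_j(𝐚₁₁,𝐚₁₃)` at `n = dr` is
`(log P₁)⁻¹·Σ_{m<P₁/n}χ(m)m^{β_j−1}((P₁/n)/m)^{β₆}log((P₁/n)/m)
 + ι₂·(log P₂)⁻¹·Σ_{m<P₂/n}χ(m)m^{β_j−1}((P₂/n)/m)^{β₇}log((P₂/n)/m)`** — (8.6): for `k = nm < P_μ`,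
`ϰ(k) = log((P_μ/n)/m)/log P_μ·((P_μ/n)/m)^{β}`, else `0`. [cite: Zhang2022LandauSiegel, §10 p. 57, §8 (8.6)] -/
theorem mSum11_eq_two_sums (hD : 2 ≤ Real.log D) (j : ℕ) {n : ℕ} (hn1 : 1 ≤ n) :
    Sec10B.mSum11 c' χ j n =
      (1 / (Real.log (P1 D) : ℂ)) * ∑ m ∈ Finset.Ico 1 ⌈P1 D / n⌉₊,
          χ (m : ZMod D) / (m : ℂ) ^ (1 - betaJ c' D j) *
            (((P1 D / n) / m : ℝ) : ℂ) ^ beta6 D * (Real.log ((P1 D / n) / m) : ℂ) +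
      iota2 * ((1 / (Real.log (P2 D) : ℂ)) * ∑ m ∈ Finset.Ico 1 ⌈P2 D / n⌉₊,
          χ (m : ZMod D) / (m : ℂ) ^ (1 - betaJ c' D j) *
            (((P2 D / n) / m : ℝ) : ℂ) ^ beta7 D * (Real.log ((P2 D / n) / m) : ℂ)) := by
  classical
  have hn0 : (0 : ℝ) < n := by exact_mod_cast hn1
  have hP : 1 < bigP D := by
    rw [bigP]; exact Real.one_lt_exp_iff.mpr (by rw [ell]; positivity)
  have hP1 : 1 < P1 D := Real.one_lt_rpow hP (by norm_num)
  have hP2 : 1 < P2 D := Sec10C.one_lt_P2 hD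
  have hceil : ∀ {Q : ℝ}, 0 ≤ Q → Q ≤ P1 D → ⌈Q / (n : ℝ)⌉₊ ≤ Nsupp D := by
    intro Q hQ0 hQ
    refine le_trans (Nat.ceil_mono ?_) (ceil_P1_le_Nsupp D hD)
    exact (div_le_self hQ0 (by exact_mod_cast hn1)).trans hQ
  have h1 := Sec10C.sum_vkGen_eq c' χ j (beta6 D) (vk1 D) (fun k => by rw [vk1]) hP1 hn1
    (hceil (by linarith) le_rfl)
  have h2 := Sec10C.sum_vkGen_eq c' χ j (beta7 D) (vk2 D) (fun k => by rw [vk2]) hP2 hn1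
    (hceil (by linarith) (P2_le_P1 D))
  unfold Sec10B.mSum11
  have hsplit : ∀ m ∈ Finset.Ico 1 (Nsupp D),
      χ (m : ZMod D) * (vk1 D (n * m) + iota2 * vk2 D (n * m)) / (m : ℂ) ^ (1 - betaJ c' D j) =
        χ (m : ZMod D) * vk1 D (n * m) / (m : ℂ) ^ (1 - betaJ c' D j) +
          iota2 * (χ (m : ZMod D) * vk2 D (n * m) / (m : ℂ) ^ (1 - betaJ c' D j)) := by
    intro m _; ring
  rw [Finset.sum_congr rfl hsplit, Finset.sum_add_distrib, ← Finset.mul_sum, h1, h2]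

/-- Lemma 8.2's sum is EMPTY for `x ≤ 1` (`⌈x⌉ ≤ 1`): in particular the `ϰ₂`-piece of the `m`-sum
vanishes for `n ≥ P₂`. [cite: Zhang2022LandauSiegel, §8 (8.6)] -/
theorem lemma82Sum_eq_zero_of_le_one (j : ℕ) (β : ℂ) {x : ℝ} (hx : x ≤ 1) :
    ∑ m ∈ Finset.Ico 1 ⌈x⌉₊, χ (m : ZMod D) / (m : ℂ) ^ (1 - betaJ c' D j) *
        ((x / m : ℝ) : ℂ) ^ β * (Real.log (x / m) : ℂ) = 0 := by
  have hceil : ⌈x⌉₊ ≤ 1 := Nat.ceil_le.mpr (by simpa using hx)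
  rw [Finset.Ico_eq_empty_of_le hceil, Finset.sum_empty]

/-- **`|Σ_{m<x} χ(m)m^{β_j−1}(x/m)^{β₇}log(x/m)| ≤ (1 + log x)log x`** for `x ≥ 1` — the `β₇`-twin of
d41's `norm_lemma82Sum_crude` (every term has modulus `≤ log x/m`; harmonic sum). Used where
`x = P₂/n ≤ T`, outside Lemma 8.2's range. [cite: Zhang2022LandauSiegel, §8 Lemma 8.2] -/
theorem norm_lemma82Sum7_crude (j : ℕ) {x : ℝ} (hx : 1 ≤ x) :
    ‖∑ m ∈ Finset.Ico 1 ⌈x⌉₊, χ (m : ZMod D) / (m : ℂ) ^ (1 - betaJ c' D j) *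
        ((x / m : ℝ) : ℂ) ^ beta7 D * (Real.log (x / m) : ℂ)‖ ≤ (1 + Real.log x) * Real.log x := by
  obtain ⟨b, hb, -⟩ := betaJ_eq_real_mul_I c' D j
  have hx0 : 0 < x := by linarith
  have hlogx : 0 ≤ Real.log x := Real.log_nonneg hx
  have hterm : ∀ m ∈ Finset.Ico 1 ⌈x⌉₊,
      ‖χ (m : ZMod D) / (m : ℂ) ^ (1 - betaJ c' D j) * ((x / m : ℝ) : ℂ) ^ beta7 D *
        (Real.log (x / m) : ℂ)‖ ≤ (1 / (m : ℝ)) * Real.log x := by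
    intro m hm
    have hm1 : 1 ≤ m := (Finset.mem_Ico.mp hm).1
    have hm0 : (0 : ℝ) < m := by exact_mod_cast hm1
    have hmx : (m : ℝ) ≤ x := by
      have h1 : m + 1 ≤ ⌈x⌉₊ := (Finset.mem_Ico.mp hm).2
      have h2 : (m : ℝ) + 1 ≤ ⌈x⌉₊ := by exact_mod_cast h1
      have h3 := Nat.ceil_lt_add_one hx0.le
      linarith
    have hχ : ‖χ (m : ZMod D)‖ ≤ 1 := DirichletCharacter.norm_le_one χ _
    have hpow : ‖(m : ℂ) ^ (1 - betaJ c' D j)‖ = m := by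
      rw [Complex.norm_natCast_cpow_of_pos hm1]
      simp [hb]
    have hx' : ‖((x / m : ℝ) : ℂ) ^ beta7 D‖ = 1 := by
      rw [Complex.norm_cpow_eq_rpow_re_of_pos (div_pos hx0 hm0)]
      simp [beta7]
    have hlog : ‖(Real.log (x / m) : ℂ)‖ ≤ Real.log x := by
      rw [Complex.norm_real, Real.norm_eq_abs, abs_of_nonneg (Real.log_nonneg (by
        rw [le_div_iff₀ hm0]; linarith))]
      rw [Real.log_div hx0.ne' hm0.ne']
      linarith [Real.log_nonneg (show (1:ℝ) ≤ m by exact_mod_cast hm1)]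
    rw [norm_mul, norm_mul, norm_div, hpow, hx', mul_one]
    calc ‖χ (m : ZMod D)‖ / m * ‖(Real.log (x / m) : ℂ)‖ ≤ 1 / m * Real.log x := by gcongr
      _ = 1 / (m : ℝ) * Real.log x := rfl
  refine (norm_sum_le _ _).trans ((Finset.sum_le_sum hterm).trans ?_)
  rw [← Finset.sum_mul]
  gcongr
  -- harmonic: `Σ_{1 ≤ m < ⌈x⌉} 1/m ≤ 1 + log x`
  have hIco : Finset.Ico 1 ⌈x⌉₊ = Finset.Ioc 0 (⌈x⌉₊ - 1) := by
    ext m; simp only [Finset.mem_Ico, Finset.mem_Ioc]; omega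
  rw [hIco]
  refine (sum_Ioc_inv_le_log (Nat.zero_le _)).trans ?_
  simp only [Nat.cast_zero, zero_add, Real.log_one, sub_zero]
  rcases Nat.eq_zero_or_pos (⌈x⌉₊ - 1) with h0 | hpos
  · rw [h0, Nat.cast_zero, Real.log_zero]; linarith
  · have hcast : ((⌈x⌉₊ - 1 : ℕ) : ℝ) = (⌈x⌉₊ : ℝ) - 1 := by
      rw [Nat.cast_sub (by omega), Nat.cast_one]
    have hle : ((⌈x⌉₊ - 1 : ℕ) : ℝ) ≤ x := by
      rw [hcast]; linarith [Nat.ceil_lt_add_one hx0.le]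
    have hpos' : (0 : ℝ) < ((⌈x⌉₊ - 1 : ℕ) : ℝ) := by exact_mod_cast hpos
    linarith [Real.log_le_log hpos' hle]

/-! ## The pointwise main-term comparison -/

/-- **Main term of the `m`-sum on the low range** (pure algebra): if the two Lemma-8.2 sums at `P₁/n`
(`μ = 6`) and `P₂/n` (`μ = 7`) are within `E₆`, `E₇` of `L′(1,χ)𝔣_{j6}(P₁/n)`, `L′(1,χ)𝔣_{j7}(P₂/n)`,
then `‖mSum11 − (L′𝔣_{j6}(P₁/n)/log P₁ + ι₂L′𝔣_{j7}(P₂/n)/log P₂)‖ ≤ E₆/log P₁ + |ι₂|E₇/log P₂`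
(`𝓛 ≥ 2`, `n ≥ 1`). [cite: Zhang2022LandauSiegel, §10 p. 57, Lemma 8.2] -/
theorem norm_mSum11_sub_main_le [NeZero D] (hD : 2 ≤ Real.log D) (j : ℕ) {n : ℕ} (hn1 : 1 ≤ n)
    {E₆ E₇ : ℝ}
    (h6 : ‖(∑ m ∈ Finset.Ico 1 ⌈P1 D / n⌉₊, χ (m : ZMod D) / (m : ℂ) ^ (1 - betaJ c' D j) *
          (((P1 D / n) / m : ℝ) : ℂ) ^ beta6 D * (Real.log ((P1 D / n) / m) : ℂ)) -
        deriv χ.LFunction 1 * frakfW c' D j 6 (P1 D / n)‖ ≤ E₆)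
    (h7 : ‖(∑ m ∈ Finset.Ico 1 ⌈P2 D / n⌉₊, χ (m : ZMod D) / (m : ℂ) ^ (1 - betaJ c' D j) *
          (((P2 D / n) / m : ℝ) : ℂ) ^ beta7 D * (Real.log ((P2 D / n) / m) : ℂ)) -
        deriv χ.LFunction 1 * frakfW c' D j 7 (P2 D / n)‖ ≤ E₇) :
    ‖Sec10B.mSum11 c' χ j n -
        (deriv χ.LFunction 1 * frakfW c' D j 6 (P1 D / n) / (Real.log (P1 D) : ℂ) +
          iota2 * (deriv χ.LFunction 1 * frakfW c' D j 7 (P2 D / n) / (Real.log (P2 D) : ℂ)))‖ ≤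
      E₆ / Real.log (P1 D) + ‖iota2‖ * (E₇ / Real.log (P2 D)) := by
  have hP : 1 < bigP D := by
    rw [bigP]; exact Real.one_lt_exp_iff.mpr (by rw [ell]; positivity)
  have hP1 : 1 < P1 D := Real.one_lt_rpow hP (by norm_num)
  have hP2 : 1 < P2 D := Sec10C.one_lt_P2 hD
  have hl1 : 0 < Real.log (P1 D) := Real.log_pos hP1
  have hl2 : 0 < Real.log (P2 D) := Real.log_pos hP2
  have hl1C : (Real.log (P1 D) : ℂ) ≠ 0 := by exact_mod_cast hl1.ne'
  have hl2C : (Real.log (P2 D) : ℂ) ≠ 0 := by exact_mod_cast hl2.ne'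
  set S₆ := ∑ m ∈ Finset.Ico 1 ⌈P1 D / n⌉₊, χ (m : ZMod D) / (m : ℂ) ^ (1 - betaJ c' D j) *
    (((P1 D / n) / m : ℝ) : ℂ) ^ beta6 D * (Real.log ((P1 D / n) / m) : ℂ) with hS₆
  set S₇ := ∑ m ∈ Finset.Ico 1 ⌈P2 D / n⌉₊, χ (m : ZMod D) / (m : ℂ) ^ (1 - betaJ c' D j) *
    (((P2 D / n) / m : ℝ) : ℂ) ^ beta7 D * (Real.log ((P2 D / n) / m) : ℂ) with hS₇
  set F₆ := deriv χ.LFunction 1 * frakfW c' D j 6 (P1 D / n) with hF₆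
  set F₇ := deriv χ.LFunction 1 * frakfW c' D j 7 (P2 D / n) with hF₇
  rw [mSum11_eq_two_sums c' χ hD j hn1]
  have e : 1 / (Real.log (P1 D) : ℂ) * S₆ + iota2 * (1 / (Real.log (P2 D) : ℂ) * S₇) -
      (F₆ / (Real.log (P1 D) : ℂ) + iota2 * (F₇ / (Real.log (P2 D) : ℂ))) =
      (S₆ - F₆) / (Real.log (P1 D) : ℂ) + iota2 * ((S₇ - F₇) / (Real.log (P2 D) : ℂ)) := by
    field_simp
    ring
  rw [e]
  have n1 : ‖(Real.log (P1 D) : ℂ)‖ = Real.log (P1 D) := by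
    rw [Complex.norm_real, Real.norm_of_nonneg hl1.le]
  have n2 : ‖(Real.log (P2 D) : ℂ)‖ = Real.log (P2 D) := by
    rw [Complex.norm_real, Real.norm_of_nonneg hl2.le]
  calc ‖(S₆ - F₆) / (Real.log (P1 D) : ℂ) + iota2 * ((S₇ - F₇) / (Real.log (P2 D) : ℂ))‖
      ≤ ‖(S₆ - F₆) / (Real.log (P1 D) : ℂ)‖ + ‖iota2 * ((S₇ - F₇) / (Real.log (P2 D) : ℂ))‖ :=
        norm_add_le _ _
    _ = ‖S₆ - F₆‖ / Real.log (P1 D) + ‖iota2‖ * (‖S₇ - F₇‖ / Real.log (P2 D)) := by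
        rw [norm_div, norm_mul, norm_div, n1, n2]
    _ ≤ E₆ / Real.log (P1 D) + ‖iota2‖ * (E₇ / Real.log (P2 D)) := by gcongr

/-! ## The printed main term: `P₂ ↦ P^{1/2}` in the `𝔣_{j7}`-term, on the whole low range -/

/-- `‖f₁/Λ₂ − f₂/Λ₅‖ ≤ ‖f₁ − f₂‖/Λ₂ + ‖f₂‖·|Λ₅ − Λ₂|/(Λ₂Λ₅)` (`Λ₂, Λ₅ > 0`). [folklore] -/
private theorem norm_div_sub_div_le (f₁ f₂ : ℂ) {Λ₂ Λ₅ : ℝ} (h2 : 0 < Λ₂) (h5 : 0 < Λ₅) :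
    ‖f₁ / (Λ₂ : ℂ) - f₂ / (Λ₅ : ℂ)‖ ≤ ‖f₁ - f₂‖ / Λ₂ + ‖f₂‖ * (|Λ₅ - Λ₂| / (Λ₂ * Λ₅)) := by
  have hΛ₂C : (Λ₂ : ℂ) ≠ 0 := by exact_mod_cast h2.ne'
  have hΛ₅C : (Λ₅ : ℂ) ≠ 0 := by exact_mod_cast h5.ne'
  have e : f₁ / (Λ₂ : ℂ) - f₂ / (Λ₅ : ℂ) =
      (f₁ - f₂) / (Λ₂ : ℂ) + f₂ * (((Λ₅ - Λ₂ : ℝ) : ℂ) / ((Λ₂ : ℂ) * (Λ₅ : ℂ))) := by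
    push_cast
    field_simp
    ring
  rw [e]
  have n2 : ‖(Λ₂ : ℂ)‖ = Λ₂ := by rw [Complex.norm_real, Real.norm_of_nonneg h2.le]
  have n5 : ‖(Λ₅ : ℂ)‖ = Λ₅ := by rw [Complex.norm_real, Real.norm_of_nonneg h5.le]
  have n52 : ‖((Λ₅ - Λ₂ : ℝ) : ℂ)‖ = |Λ₅ - Λ₂| := by rw [Complex.norm_real, Real.norm_eq_abs]
  refine (norm_add_le _ _).trans (le_of_eq ?_)
  simp only [norm_div, norm_mul, n2, n5, n52]

/-- The scalar bookkeeping of the `P₂ ↦ P^{1/2}` replacement: with `Λ₂ = 0.5ℓ⁹ − 10τ ≥ 0.4ℓ⁹`,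
`E ≤ 940aτ`, `F ≤ 29`, `3 ≤ aℓ⁹`: `E/Λ₂ + F·10τ/(Λ₂·0.5ℓ⁹) ≤ 5000τa/ℓ⁹`. [folklore] -/
private theorem P2_shift_arith {a τ ℓ E F Λ₂ : ℝ} (hℓ : 0 < ℓ) (hτ : 0 ≤ τ) (ha : 0 ≤ a)
    (haℓ : 3 ≤ a * ℓ ^ 9) (hΛ₂ : 0.4 * ℓ ^ 9 ≤ Λ₂) (hE : E ≤ 94 * a * (10 * τ)) (hF : F ≤ 29) :
    E / Λ₂ + F * (10 * τ / (Λ₂ * (0.5 * ℓ ^ 9))) ≤ 5000 * τ * a / ℓ ^ 9 := by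
  have hℓ9 : 0 < ℓ ^ 9 := by positivity
  have hΛ₂0 : 0 < Λ₂ := by nlinarith
  have h1 : E / Λ₂ ≤ 94 * a * (10 * τ) / (0.4 * ℓ ^ 9) :=
    div_le_div₀ (by positivity) hE (by positivity) hΛ₂
  have h2 : F * (10 * τ / (Λ₂ * (0.5 * ℓ ^ 9))) ≤ 29 * (10 * τ / (0.4 * ℓ ^ 9 * (0.5 * ℓ ^ 9))) := by
    gcongr
  have e1 : 94 * a * (10 * τ) / (0.4 * ℓ ^ 9) = 2350 * (τ * a / ℓ ^ 9) := by
    field_simp; ring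
  have e2 : 29 * (10 * τ / (0.4 * ℓ ^ 9 * (0.5 * ℓ ^ 9))) = 1450 * (τ / ℓ ^ 9) / ℓ ^ 9 := by
    field_simp; ring
  have h3 : 1450 * (τ / ℓ ^ 9) / ℓ ^ 9 ≤ 500 * (τ * a / ℓ ^ 9) := by
    rw [div_le_iff₀ hℓ9]
    have : 500 * (τ * a / ℓ ^ 9) * ℓ ^ 9 = 500 * τ * a := by field_simp
    rw [this]
    have h4 : τ / ℓ ^ 9 * 3 ≤ τ * a := by
      rw [div_mul_eq_mul_div, div_le_iff₀ hℓ9]; nlinarith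
    nlinarith
  calc E / Λ₂ + F * (10 * τ / (Λ₂ * (0.5 * ℓ ^ 9)))
      ≤ 2350 * (τ * a / ℓ ^ 9) + 1450 * (τ / ℓ ^ 9) / ℓ ^ 9 := by rw [← e1, ← e2]; exact add_le_add h1 h2
    _ ≤ 2350 * (τ * a / ℓ ^ 9) + 500 * (τ * a / ℓ ^ 9) := by linarith
    _ ≤ 5000 * τ * a / ℓ ^ 9 := by
        have : 0 ≤ τ * a / ℓ ^ 9 := by positivity
        rw [show 5000 * τ * a / ℓ ^ 9 = 5000 * (τ * a / ℓ ^ 9) by ring]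
        linarith

/-- **The `P₂ ↦ P^{1/2}` replacement in the `𝔣_{j7}`-term on the WHOLE low range**: for `𝓛 ≥ 5`,
`5|c′|α𝓛 ≤ 1` and `1 ≤ n < P^{1/2}`:
`‖𝔣_{j7}(P₂/n)/log P₂ − 𝔣_{j7}(P^{1/2}/n)/(0.5 log P)‖ ≤ 5000·𝓛^{1.1}·α/𝓛⁹`
(`log P₂ = 0.5𝓛⁹ − 10𝓛^{1.1}`, `‖𝔣‖ ≤ 29`, `‖∂_L𝔣‖ ≤ 94α`, here `α|log(P^{1/2}/n)| ≤ π/2`) — zl-w10-p1's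
`Sec10C.norm_frakfW7_P2_div_sub_le` without its window hypothesis `P^{0.496} ≤ n`.
[cite: Zhang2022LandauSiegel, §10 p. 57] -/
theorem norm_frakfW7_P2_div_sub_le_low (hL5 : 5 ≤ ell D) (hc : 5 * |c'| * alpha D * ell D ≤ 1) (j : ℕ)
    {n : ℕ} (hn1 : 1 ≤ n) (hhi : (n : ℝ) < bigP D ^ (0.5 : ℝ)) :
    ‖frakfW c' D j 7 (Skeleton.P2 D / n) / (Real.log (Skeleton.P2 D) : ℂ) -
        frakfW c' D j 7 (bigP D ^ (0.5 : ℝ) / n) / ((0.5 * Real.log (bigP D) : ℝ) : ℂ)‖ ≤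
      5000 * ell D ^ (1.1 : ℝ) * alpha D / ell D ^ 9 := by
  have hℓ0 : 0 < ell D := by linarith
  have hℓ1 : 1 ≤ ell D := by linarith
  have hn0 : (0 : ℝ) < n := by exact_mod_cast hn1
  have hn1' : (1 : ℝ) ≤ n := by exact_mod_cast hn1
  have hP0 : 0 < bigP D := Real.exp_pos _
  have hT0 : 0 < bigT D := Real.exp_pos _
  have hα : alpha D = π / ell D ^ 9 := by rw [alpha, bigP, Real.log_exp]
  have hα0 : 0 < alpha D := by rw [hα]; positivity
  have hlogP : Real.log (bigP D) = ell D ^ 9 := by rw [bigP, Real.log_exp]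
  have hlogT : Real.log (bigT D) = ell D ^ (1.1 : ℝ) := by rw [bigT, Real.log_exp]
  set τ : ℝ := ell D ^ (1.1 : ℝ) with hτ
  have hτ0 : 0 < τ := Real.rpow_pos_of_pos hℓ0 _
  have hτ2 : τ ≤ ell D ^ 2 := (bigT_lt_rpow hL5).1
  have h7 : (78125 : ℝ) ≤ ell D ^ 7 := by
    calc (78125 : ℝ) = 5 ^ 7 := by norm_num
      _ ≤ ell D ^ 7 := pow_le_pow_left₀ (by norm_num) hL5 7
  have h9 : ell D ^ 9 = ell D ^ 2 * ell D ^ 7 := by ring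
  have hτsmall : 100 * τ ≤ 0.1 * ell D ^ 9 := by rw [h9]; nlinarith [pow_nonneg hℓ0.le 2]
  have hP2pos : 0 < Skeleton.P2 D := div_pos (Real.rpow_pos_of_pos hP0 _) (pow_pos hT0 10)
  -- the two logarithms
  have hlogP2 : Real.log (Skeleton.P2 D) = 0.5 * ell D ^ 9 - 10 * τ := by
    rw [Skeleton.P2, Real.log_div (Real.rpow_pos_of_pos hP0 _).ne' (pow_pos hT0 10).ne',
      Real.log_rpow hP0, Real.log_pow, hlogT, hlogP]; push_cast; ring
  have hΛ2pos : 0 < Real.log (Skeleton.P2 D) := by rw [hlogP2]; nlinarith [pow_nonneg hℓ0.le 9]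
  have hΛ5 : (0.5 : ℝ) * Real.log (bigP D) = 0.5 * ell D ^ 9 := by rw [hlogP]
  have hΛ5pos : 0 < (0.5 : ℝ) * Real.log (bigP D) := by rw [hΛ5]; positivity
  -- `𝔣_{j7}` at the two points
  have hμ : betaMu D 7 = beta7 D := by norm_num [betaMu]
  have hL12 : Real.log (Skeleton.P2 D / n) - Real.log (bigP D ^ (0.5 : ℝ) / n) = -(10 * τ) := by
    rw [Real.log_div hP2pos.ne' hn0.ne', Real.log_div (Real.rpow_pos_of_pos hP0 _).ne' hn0.ne',
      hlogP2, Real.log_rpow hP0, hlogP]; ring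
  -- sizes: `0 ≤ L₂ = log(P^{1/2}/n) ≤ 0.5ℓ⁹`, so `α|L₂| ≤ π/2 ≤ 4`
  have hlogn_lo : 0 ≤ Real.log n := Real.log_nonneg hn1'
  have hlogn_hi : Real.log n < 0.5 * ell D ^ 9 := by
    rw [← Real.log_exp (0.5 * ell D ^ 9), ← bigP_rpow]; exact Real.log_lt_log hn0 hhi
  have hL₂abs : |Real.log (bigP D ^ (0.5 : ℝ) / n)| ≤ 0.5 * ell D ^ 9 := by
    rw [Real.log_div (Real.rpow_pos_of_pos hP0 _).ne' hn0.ne', Real.log_rpow hP0, hlogP, abs_le]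
    constructor <;> linarith
  have hαL₂ : alpha D * |Real.log (bigP D ^ (0.5 : ℝ) / n)| ≤ 4 := by
    calc alpha D * |Real.log (bigP D ^ (0.5 : ℝ) / n)| ≤ (π / ell D ^ 9) * (0.5 * ell D ^ 9) := by
          rw [hα]; gcongr
      _ = 0.5 * π := by field_simp
      _ ≤ 4 := by nlinarith [Real.pi_lt_four]
  obtain ⟨h7re, h7n⟩ := Sec10C.beta7_facts (D := D) hα0.le
  have hβj := Section8AbelProfiles.norm_betaJ_le c' hα0.le hℓ0.le hc j
  have hF2 : ‖frakfW c' D j 7 (bigP D ^ (0.5 : ℝ) / n)‖ ≤ 29 := by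
    rw [frakfW, hμ]; exact (Section8AbelProfiles.norm_frakf_le h7re h7n hβj hαL₂).1
  have hdiff : ‖frakfW c' D j 7 (Skeleton.P2 D / n) - frakfW c' D j 7 (bigP D ^ (0.5 : ℝ) / n)‖ ≤
      94 * alpha D * (10 * τ) := by
    rw [frakfW, frakfW, hμ]
    have h := Sec10C.norm_frakf_sub_frakf_le (L := Real.log (Skeleton.P2 D / n)) h7re h7n hβj hαL₂
    rw [hL12, abs_neg, abs_of_pos (by positivity)] at h
    exact h
  refine (norm_div_sub_div_le _ _ hΛ2pos hΛ5pos).trans ?_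
  rw [hlogP2, hΛ5]
  have hgap : |0.5 * ell D ^ 9 - (0.5 * ell D ^ 9 - 10 * τ)| = 10 * τ := by
    rw [show 0.5 * ell D ^ 9 - (0.5 * ell D ^ 9 - 10 * τ) = 10 * τ by ring, abs_of_pos (by positivity)]
  rw [hgap]
  have hΛ2ge : 0.4 * ell D ^ 9 ≤ 0.5 * ell D ^ 9 - 10 * τ := by nlinarith [pow_nonneg hℓ0.le 9]
  have haℓ : 3 ≤ alpha D * ell D ^ 9 := by
    rw [hα, div_mul_cancel₀ _ (by positivity)]; linarith [Real.pi_gt_three]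
  exact P2_shift_arith hℓ0 hτ0.le hα0.le haℓ hΛ2ge hdiff hF2

end Literature.NumberTheory.LFunctions.Zhang2022.Skeleton
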